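import Mathlib
import Summits.KontsevichZagierPeriods.Zeta5Search.BrickLevelReductionInf

/-!
# BrickTwistedHarmonicLaws — the ° residue law, the centre, the two-scale mechanism and the hole comparison for the
`C`-TWISTED HARMONIC CELLS `Σ_{s=1}^{A} w_s·c_{K,s}(n)·H_K^{(s+C)}` of the brick kernels, at an odd prime `p`
(cell `pub-zeta5`, seat ct-1 g45)

HONEST FRAMING: systematic search; no irrationality claim unless certified.  `p`-ADIC BOOKKEEPING (odd `p`) of the twisted
harmonic cells of the brick kernels `R_n(t) = n!^{A−2B}(t + n/2)^ε∏(t−j)^B∏(t+n+j)^B/∏(t+k)^A`: for a shift `C ≥ 0` and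
`p`-integral weights `w_s`, the quantity `Z^{(w,C)}_K(n) := Σ_{s=1}^{A} w_s·c_{K,s}(n)·H_K^{(s+C)}` (`c_{K,s} = BrickLaurent.cell`,
`H_K^{(e)} = BrickHarmonicBlocks.hsum e K`; written out in full in every statement — no definition is introduced), with the
normalisation `p^{(L+1)(A+C)}`.  At `w ≡ 1`, `C = 0` this is minus zi-p2's harmonic cell `cellZero`; at `w_s = binom(s+C−1, C)` it
is `(−1)^{C+1}` times the summand of Krattenthaler–Rivoal's constant term `p_{0,C,n}(1)` (ct-1 g45's
`BrickDenominatorsOddC.pZero_one_eq_twisted`).  Nothing about `ζ(5)`; no `γ` / record statement; records in print UNMOVED.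
Theorems only (0 `def`).

WHY: every harmonic-cell lemma of zi-eng's chain is TERMWISE in `s` — a depth law for `p^{(L+1)(A−s)}c_{K,s}` times the harmonic
law `p^{(L+1)e}H_j^{(e)} ≡ p^{Le}H_{⌊j/p⌋}^{(e)} (mod p^{L+1})` (`BrickResidueLawMain.level_hsum_sub_le`, any `e ≥ 1`) — so the
same proofs run with `e = s + C` and an extra `p`-integral factor `w_s`.  This file redoes, for `Z^{(w,C)}`:
* `residueLaw_circ_twist` — `BrickResidueLawCirc.residueLaw_circ_zero` (° cells, multiplier `λ`);
* `centre_twist_le` — `BrickLevelReduction.centre_cellZero_le` (the exact centre of the full kernel);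
* `hatTwist_main_sub_le`, `twoScale_twist` — `BrickHatReduction.hatLaurentZero_main_sub_le`, `twoScale_zero` (the twisted hat
  quantity `Σ_s w_s·(p^{L(A−s)}[T^{A−s}](F̃_J E))·(p^{L(s+C)}H_J^{(s+C)})` written out);
* `hole_twist_le` — `BrickLevelReductionInf.hole_cellZero_le` (a hole cell against its main term, `exp(−(A+L))`).
CONSUMER: ct-1 g45's `BrickTwistedHarmonicReduction` (one-level reduction, PROPOSITION H^∞ for `Z^{(w,C)}`, and Krattenthaler–Rivoal's
Théorème 1 (ii) for EVERY `C` at odd primes).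
-/

namespace Summit.KontsevichZagierPeriods.Zeta5Search.BrickTwistedHarmonicLaws

open Finset Nat Polynomial WithZero
open Summit.KontsevichZagierPeriods.Zeta5Search.BrickTopCoefficient (cTop)
open Summit.KontsevichZagierPeriods.Zeta5Search.BrickLaurent (laurentSeries laurent cell laurent_zero)
open Summit.KontsevichZagierPeriods.Zeta5Search.BrickHarmonicBlocks (hsum)
open Summit.KontsevichZagierPeriods.Zeta5Search.ScaledSeries (IsSlopeInt)
open Summit.KontsevichZagierPeriods.Zeta5Search.BrickLambda (le_one_of_cong cTop_zero_ne_zero)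
open Summit.KontsevichZagierPeriods.Zeta5Search.BrickResidueLawMain (cong_mul_le level_laurent_integral level_hsum_integral
  level_hsum_sub_le)
open Summit.KontsevichZagierPeriods.Zeta5Search.BrickResidueLawCirc (residueLaw_circ_depth lambda_circ_le_one)
open Summit.KontsevichZagierPeriods.Zeta5Search.BrickLevelReduction (centre_cell_le)
open Summit.KontsevichZagierPeriods.Zeta5Search.BrickHatReduction (hatLaurent twoScale_depth hatLaurent_main_sub_le
  level_hatLaurent_integral)
open Summit.KontsevichZagierPeriods.Zeta5Search.BrickHoleStrip (holePoly padicValuation_holePoly_coeff_le)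
open Summit.KontsevichZagierPeriods.Zeta5Search.BrickLevelReductionInf (hole_data)

noncomputable section

variable {p : ℕ} [Fact p.Prime]

/-- Splitting the normalisation: `p^{m(A+C)} = p^{m(A−s)}·p^{m(s+C)}` for `s ≤ A`. -/
theorem pow_split (p m A C : ℕ) {s : ℕ} (hs : s ≤ A) :
    (p : ℚ) ^ (m * (A + C)) = (p : ℚ) ^ (m * (A - s)) * (p : ℚ) ^ (m * (s + C)) := by
  rw [← pow_add, ← mul_add]; congr 2; omega

/-! ## The ° residue law for the twisted harmonic cell -/

section circ

variable (hp2 : p ≠ 2) {A B ε N n₀ J j₀ n j L : ℕ} (hAB : 2 * B ≤ A) (hn : n = n₀ + N * p) (hj : j = j₀ + J * p)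
  (hN : N < p ^ (L + 1)) (hn₀ : n₀ < p) (hj₀ : j₀ ≤ n₀) (hJN : J ≤ N) (hcen : 2 * j ≠ n ∨ ε = 0)
  {C : ℕ} {w : ℕ → ℚ} (hw : ∀ s, Rat.padicValuation p (w s) ≤ 1)
include hp2 hAB hn hj hN hn₀ hj₀ hJN hcen hw

/-- **LEMMA 2 (ii) for the twisted harmonic cell of a ° cell** (`n = n₀ + Np`, `j = j₀ + Jp`, `j₀ ≤ n₀ < p`, `J ≤ N < p^{L+1}`,
`λ·c̃_{J,A}(N) = c_{j,A}(n)`):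
`v(p^{(L+1)(A+C)}·Z^{(w,C)}_j(n) − λ·p^{L(A+C)}·Z̃^{(w,C)}_J(N)) ≤ exp(−(L+1))`. -/
theorem residueLaw_circ_twist {lam : ℚ} (hmul : lam * cTop A B 0 N J = cTop A B ε n j) :
    Rat.padicValuation p ((p : ℚ) ^ ((L + 1) * (A + C)) * ∑ s ∈ Icc 1 A, w s * (cell A B ε n j s * hsum (s + C) j) -
      lam * ((p : ℚ) ^ (L * (A + C)) * ∑ s ∈ Icc 1 A, w s * (cell A B 0 N J s * hsum (s + C) J))) ≤
      exp (-((L : ℤ) + 1)) := by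
  have hp : p.Prime := Fact.out
  have hJ : j / p = J := by rw [hj, Nat.add_mul_div_right _ _ hp.pos, Nat.div_eq_of_lt (by omega), zero_add]
  have hJlt : J < p ^ (L + 1) := lt_of_le_of_lt hJN hN
  have hlt1 : exp (-((L : ℤ) + 1)) < 1 := by rw [← exp_zero, exp_lt_exp]; omega
  have hr1 : Rat.padicValuation p lam ≤ 1 := lambda_circ_le_one hp2 hn hj hn₀ hj₀ hJN hmul
  have hx : (p : ℚ) ^ ((L + 1) * (A + C)) * ∑ s ∈ Icc 1 A, w s * (cell A B ε n j s * hsum (s + C) j) =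
      ∑ s ∈ Icc 1 A, w s * ((((p : ℚ) ^ ((L + 1) * (A - s)) * cell A B ε n j s)) *
        ((p : ℚ) ^ ((L + 1) * (s + C)) * hsum (s + C) j)) := by
    rw [Finset.mul_sum]
    refine Finset.sum_congr rfl fun s hs => ?_
    rw [pow_split p (L + 1) A C (mem_Icc.1 hs).2]; ring
  have hy : lam * ((p : ℚ) ^ (L * (A + C)) * ∑ s ∈ Icc 1 A, w s * (cell A B 0 N J s * hsum (s + C) J)) =
      ∑ s ∈ Icc 1 A, w s * ((lam * ((p : ℚ) ^ (L * (A - s)) * cell A B 0 N J s)) *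
        ((p : ℚ) ^ (L * (s + C)) * hsum (s + C) J)) := by
    rw [Finset.mul_sum, Finset.mul_sum]
    refine Finset.sum_congr rfl fun s hs => ?_
    rw [pow_split p L A C (mem_Icc.1 hs).2]; ring
  rw [hx, hy, ← Finset.sum_sub_distrib]
  refine Valuation.map_sum_le _ fun s hs => ?_
  have hs' := mem_Icc.1 hs
  rw [← mul_sub, map_mul]
  refine (mul_le_mul' (hw s) ?_).trans (by rw [one_mul])
  have hlaw := residueLaw_circ_depth hp2 hAB hn hj hN hn₀ hj₀ hJN hcen hmul (A - s)
  have hH := level_hsum_sub_le (p := p) (show 1 ≤ s + C by omega) L j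
  rw [hJ] at hH
  have hy₁ : Rat.padicValuation p (lam * ((p : ℚ) ^ (L * (A - s)) * cell A B 0 N J s)) ≤ 1 := by
    rw [map_mul]; exact mul_le_one' hr1 (level_laurent_integral hp2 hAB hN hJN (A - s))
  exact cong_mul_le hlaw hH (le_one_of_cong (lt_of_le_of_lt hlaw hlt1) hy₁) (level_hsum_integral hJlt (s + C))

end circ

/-! ## The exact centre of the full kernel -/

/-- **The centre twisted harmonic cell at level `L+1`**: `v(p^{(L+1)(A+C)}·Z^{(w,C)}_k(n)) ≤ exp(−(L+1))` for `2k = n < p^{L+2}`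
(full kernel `ε = 1`, odd `p`, `2B ≤ A`). -/
theorem centre_twist_le (hp2 : p ≠ 2) {A B L n : ℕ} (hAB : 2 * B ≤ A) (hn : n < p ^ (L + 1 + 1)) {k : ℕ} (hk : k ≤ n)
    (hc : 2 * k = n) (C : ℕ) {w : ℕ → ℚ} (hw : ∀ s, Rat.padicValuation p (w s) ≤ 1) :
    Rat.padicValuation p ((p : ℚ) ^ ((L + 1) * (A + C)) * ∑ s ∈ Icc 1 A, w s * (cell A B 1 n k s * hsum (s + C) k)) ≤
      exp (-((L : ℤ) + 1)) := by
  have hklt : k < p ^ (L + 1 + 1) := lt_of_le_of_lt hk hn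
  rw [Finset.mul_sum]
  refine Valuation.map_sum_le _ fun s hs => ?_
  rw [pow_split p (L + 1) A C (mem_Icc.1 hs).2,
    show (p : ℚ) ^ ((L + 1) * (A - s)) * (p : ℚ) ^ ((L + 1) * (s + C)) * (w s * (cell A B 1 n k s * hsum (s + C) k)) =
      w s * ((((p : ℚ) ^ ((L + 1) * (A - s)) * cell A B 1 n k s)) * ((p : ℚ) ^ ((L + 1) * (s + C)) * hsum (s + C) k)) by ring,
    map_mul, map_mul]
  refine (mul_le_mul' (hw s) (mul_le_mul' (centre_cell_le hp2 hAB hn hk hc s) (level_hsum_integral hklt (s + C)))).trans ?_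
  rw [one_mul, mul_one]

/-! ## The two-scale mechanism for the twisted harmonic cell -/

section generic

variable (hp2 : p ≠ 2) {A B : ℕ} (hAB : 2 * B ≤ A) {M J L : ℕ} (hM : M < p ^ (L + 1)) (hJ : J ≤ M)
  {E : ℚ[X]} (hE : ∀ h, Rat.padicValuation p (E.coeff h) ≤ 1) {C : ℕ} {w : ℕ → ℚ} (hw : ∀ s, Rat.padicValuation p (w s) ≤ 1)
include hp2 hAB hM hJ hE hw

/-- **The twisted hat quantity against the plain one**:
`v(Σ_s w_s·(p^{L(A−s)}[T^{A−s}](F̃_J E))·(p^{L(s+C)}H_J^{(s+C)}) − E(0)·p^{L(A+C)}·Z̃^{(w,C)}_J(M)) ≤ exp(−L)`. -/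
theorem hatTwist_main_sub_le :
    Rat.padicValuation p (∑ s ∈ Icc 1 A, w s * (((p : ℚ) ^ (L * (A - s)) * hatLaurent A B E M J (A - s)) *
        ((p : ℚ) ^ (L * (s + C)) * hsum (s + C) J)) -
      E.eval 0 * ((p : ℚ) ^ (L * (A + C)) * ∑ s ∈ Icc 1 A, w s * (cell A B 0 M J s * hsum (s + C) J))) ≤
      exp (-(L : ℤ)) := by
  have hJlt : J < p ^ (L + 1) := lt_of_le_of_lt hJ hM
  have hy : E.eval 0 * ((p : ℚ) ^ (L * (A + C)) * ∑ s ∈ Icc 1 A, w s * (cell A B 0 M J s * hsum (s + C) J)) =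
      ∑ s ∈ Icc 1 A, w s * ((E.eval 0 * ((p : ℚ) ^ (L * (A - s)) * laurent A B 0 M J (A - s))) *
        ((p : ℚ) ^ (L * (s + C)) * hsum (s + C) J)) := by
    rw [Finset.mul_sum, Finset.mul_sum]
    refine Finset.sum_congr rfl fun s hs => ?_
    rw [pow_split p L A C (mem_Icc.1 hs).2, show cell A B 0 M J s = laurent A B 0 M J (A - s) from rfl]
    ring
  rw [hy, ← Finset.sum_sub_distrib]
  refine Valuation.map_sum_le _ fun s _ => ?_
  rw [← mul_sub, map_mul, ← sub_mul, map_mul]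
  refine (mul_le_mul' (hw s) (mul_le_mul' (hatLaurent_main_sub_le hp2 hAB hM hJ hE _)
    (level_hsum_integral hJlt (s + C)))).trans ?_
  rw [one_mul, mul_one]

variable {ε N K : ℕ} {U : PowerSeries ℚ} (hU0 : PowerSeries.constantCoeff U = 1) (hUint : IsSlopeInt p (-1) 0 U)
  {a : ℚ} (hid : PowerSeries.rescale (p : ℚ) (laurentSeries A B ε N K) =
    PowerSeries.C a * laurentSeries A B 0 M J * ((E : ℚ[X]) : PowerSeries ℚ) * U)
include hU0 hUint hid

/-- **THE TWO-SCALE MECHANISM for the twisted harmonic cell**: with `⌊K/p⌋ = J`,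
`v(p^{(L+1)(A+C)}·Z^{(w,C)}_K(N) − a·Σ_s w_s·(p^{L(A−s)}[T^{A−s}](F̃_J E))·(p^{L(s+C)}H_J^{(s+C)})) ≤ v(a)·exp(−(L+1))`. -/
theorem twoScale_twist (hKJ : K / p = J) :
    Rat.padicValuation p ((p : ℚ) ^ ((L + 1) * (A + C)) * ∑ s ∈ Icc 1 A, w s * (cell A B ε N K s * hsum (s + C) K) -
      a * ∑ s ∈ Icc 1 A, w s * (((p : ℚ) ^ (L * (A - s)) * hatLaurent A B E M J (A - s)) *
        ((p : ℚ) ^ (L * (s + C)) * hsum (s + C) J))) ≤ Rat.padicValuation p a * exp (-((L : ℤ) + 1)) := by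
  have hJlt : J < p ^ (L + 1) := lt_of_le_of_lt hJ hM
  have hx : (p : ℚ) ^ ((L + 1) * (A + C)) * ∑ s ∈ Icc 1 A, w s * (cell A B ε N K s * hsum (s + C) K) =
      ∑ s ∈ Icc 1 A, w s * ((((p : ℚ) ^ ((L + 1) * (A - s)) * cell A B ε N K s)) *
        ((p : ℚ) ^ ((L + 1) * (s + C)) * hsum (s + C) K)) := by
    rw [Finset.mul_sum]
    refine Finset.sum_congr rfl fun s hs => ?_
    rw [pow_split p (L + 1) A C (mem_Icc.1 hs).2]; ring
  have hy : a * ∑ s ∈ Icc 1 A, w s * (((p : ℚ) ^ (L * (A - s)) * hatLaurent A B E M J (A - s)) *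
        ((p : ℚ) ^ (L * (s + C)) * hsum (s + C) J)) =
      ∑ s ∈ Icc 1 A, w s * ((a * ((p : ℚ) ^ (L * (A - s)) * hatLaurent A B E M J (A - s))) *
        ((p : ℚ) ^ (L * (s + C)) * hsum (s + C) J)) := by
    rw [Finset.mul_sum]; exact Finset.sum_congr rfl fun s _ => by ring
  rw [hx, hy, ← Finset.sum_sub_distrib]
  refine Valuation.map_sum_le _ fun s hs => ?_
  have hs' := mem_Icc.1 hs
  rw [← mul_sub, map_mul]
  refine (mul_le_mul' (hw s) ?_).trans (by rw [one_mul])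
  have h₁ := twoScale_depth hp2 hAB hM hJ hE hU0 hUint hid (A - s)
  rw [show cell A B ε N K s = laurent A B ε N K (A - s) from rfl]
  have h₂ := level_hsum_sub_le (p := p) (show 1 ≤ s + C by omega) L K
  rw [hKJ] at h₂
  have hy₁ : Rat.padicValuation p (a * ((p : ℚ) ^ (L * (A - s)) * hatLaurent A B E M J (A - s))) ≤
      Rat.padicValuation p a := by
    rw [map_mul]
    calc _ ≤ Rat.padicValuation p a * 1 := mul_le_mul' le_rfl (level_hatLaurent_integral hp2 hAB hM hJ hE _)
      _ = _ := mul_one _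
  have hx₁ : Rat.padicValuation p ((p : ℚ) ^ ((L + 1) * (A - s)) * laurent A B ε N K (A - s)) ≤
      Rat.padicValuation p a := by
    have h := Valuation.map_add (Rat.padicValuation p)
      ((p : ℚ) ^ ((L + 1) * (A - s)) * laurent A B ε N K (A - s) -
        a * ((p : ℚ) ^ (L * (A - s)) * hatLaurent A B E M J (A - s)))
      (a * ((p : ℚ) ^ (L * (A - s)) * hatLaurent A B E M J (A - s)))
    rw [sub_add_cancel] at h
    refine h.trans (max_le (h₁.trans ?_) hy₁)
    calc _ ≤ Rat.padicValuation p a * 1 := mul_le_mul' le_rfl (by rw [← exp_zero, exp_le_exp]; omega)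
      _ = _ := mul_one _
  have hy₂ := level_hsum_integral (p := p) hJlt (s + C)
  rw [show (p : ℚ) ^ ((L + 1) * (A - s)) * laurent A B ε N K (A - s) * ((p : ℚ) ^ ((L + 1) * (s + C)) * hsum (s + C) K) -
      a * ((p : ℚ) ^ (L * (A - s)) * hatLaurent A B E M J (A - s)) * ((p : ℚ) ^ (L * (s + C)) * hsum (s + C) J) =
    (p : ℚ) ^ ((L + 1) * (A - s)) * laurent A B ε N K (A - s) *
        ((p : ℚ) ^ ((L + 1) * (s + C)) * hsum (s + C) K - (p : ℚ) ^ (L * (s + C)) * hsum (s + C) J) +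
      ((p : ℚ) ^ ((L + 1) * (A - s)) * laurent A B ε N K (A - s) -
        a * ((p : ℚ) ^ (L * (A - s)) * hatLaurent A B E M J (A - s))) * ((p : ℚ) ^ (L * (s + C)) * hsum (s + C) J) by ring]
  refine Valuation.map_add_le _ ?_ ?_
  · rw [map_mul]; exact mul_le_mul' hx₁ h₂
  · rw [map_mul]
    calc _ ≤ Rat.padicValuation p a * exp (-((L : ℤ) + 1)) * 1 := mul_le_mul' h₁ hy₂
      _ = _ := mul_one _

end generic

/-! ## A hole cell against its main term -/

section hole

variable (hp2 : p ≠ 2) {A B ε n₀ m K k₀ L : ℕ} (hAB : 2 * B ≤ A) (hε : ε ≤ 1) (hn₀ : n₀ < p) (hm : m < p ^ (L + 1))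
  (hK : K ≤ m) (hk₀ : n₀ < k₀) (hk₀p : k₀ < p) (hcen : 2 * (k₀ + K * p) ≠ n₀ + (m + 1) * p ∨ ε = 0)
  {C : ℕ} {w : ℕ → ℚ} (hw : ∀ s, Rat.padicValuation p (w s) ≤ 1)
include hp2 hAB hε hn₀ hm hK hk₀ hk₀p hcen hw

/-- **A hole twisted harmonic cell against its main term**: for `g ∈ ℤ_(p)` and `μ_k = c_{k,A}(n)/c̃_{K,A}(m)`
(`n = n₀ + (m+1)p`, `k = k₀ + Kp`, `n₀ < k₀ < p`):
`v(g·p^{(L+1)(A+C)}Z^{(w,C)}_k(n) − g·μ_k·p^{L(A+C)}Z̃^{(w,C)}_K(m)) ≤ exp(−(A+L))`. -/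
theorem hole_twist_le {g : ℚ} (hg : Rat.padicValuation p g ≤ 1) :
    Rat.padicValuation p (g * ((p : ℚ) ^ ((L + 1) * (A + C)) *
        ∑ s ∈ Icc 1 A, w s * (cell A B ε (n₀ + (m + 1) * p) (k₀ + K * p) s * hsum (s + C) (k₀ + K * p))) -
      g * (cTop A B ε (n₀ + (m + 1) * p) (k₀ + K * p) / cTop A B 0 m K) *
        ((p : ℚ) ^ (L * (A + C)) * ∑ s ∈ Icc 1 A, w s * (cell A B 0 m K s * hsum (s + C) K))) ≤
      exp (-((A : ℤ) + L)) := by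
  have hp : p.Prime := Fact.out
  obtain ⟨U, hU0, hUint, a, hid, hμ, hva⟩ := hole_data hp2 hAB hε hn₀ hm hK hk₀ hk₀p hcen
  have hE := padicValuation_holePoly_coeff_le hp2 B ε n₀ m k₀ K
  have hKJ : (k₀ + K * p) / p = K := by rw [Nat.add_mul_div_right _ _ hp.pos, Nat.div_eq_of_lt hk₀p, zero_add]
  have h1 := twoScale_twist hp2 hAB hm hK hE (C := C) hw hU0 hUint hid hKJ
  have h2 := hatTwist_main_sub_le hp2 hAB hm hK hE (C := C) hw
  set Zb := (p : ℚ) ^ ((L + 1) * (A + C)) *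
    ∑ s ∈ Icc 1 A, w s * (cell A B ε (n₀ + (m + 1) * p) (k₀ + K * p) s * hsum (s + C) (k₀ + K * p)) with hZb
  set Zs := (p : ℚ) ^ (L * (A + C)) * ∑ s ∈ Icc 1 A, w s * (cell A B 0 m K s * hsum (s + C) K) with hZs
  set HZ := ∑ s ∈ Icc 1 A, w s * (((p : ℚ) ^ (L * (A - s)) * hatLaurent A B (holePoly B ε p n₀ m k₀ K) m K (A - s)) *
    ((p : ℚ) ^ (L * (s + C)) * hsum (s + C) K)) with hHZ
  rw [hμ, show g * Zb - g * (a * (holePoly B ε p n₀ m k₀ K).eval 0) * Zs =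
    g * ((Zb - a * HZ) + a * (HZ - (holePoly B ε p n₀ m k₀ K).eval 0 * Zs)) by ring, map_mul]
  refine (mul_le_mul' hg ((Valuation.map_add _ _ _).trans (max_le (h1.trans ?_) ?_))).trans (by rw [one_mul])
  · calc _ ≤ exp (-(A : ℤ)) * exp (-((L : ℤ) + 1)) := mul_le_mul' hva le_rfl
      _ ≤ _ := by rw [← exp_add, exp_le_exp]; omega
  · rw [map_mul]
    calc _ ≤ exp (-(A : ℤ)) * exp (-(L : ℤ)) := mul_le_mul' hva h2
      _ = _ := by rw [← exp_add]; congr 1; ring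

end hole

end

end Summit.KontsevichZagierPeriods.Zeta5Search.BrickTwistedHarmonicLaws
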